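import Summits.CriticalPhenomena.PercolationContinuityZ3.Theorems.PercNearOneGluingNoHeavyQuantSliceDeepLowsBudget
import HarnessLib

/-!
# QUANT lane R8, T-DEC: SL-λ* for any number of deep lows — the giant pool `g·(H_λ) + (1−g)·(H_j′)` (LEAD-NOTES-G23 N49, Theorem A)

builds on p205010 (kernel theorem, internal audit signed; external expert review pending)

Support file (`--supports stmt-CriticalPhenomena-4575`), QUANT lane lead seat prim-quant-lead (gen 23), rung R8 of
`run/shared/lean/prim/quant/LADDER.md`.  Theorems only; standard axioms, no sorries.  Second half of the budget of Theorem A (see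
`…QuantSliceDeepLowsBudget` for the statement, the routing and the key step `sum_dlAd_ge`):
* `pool_of_flow_lam` — (H_λ) in pool form: under the support hypotheses a deep low is compatible at layer `λ` only with atoms `> λ`
  (band-like atoms `≤ λ` are incompatible with deep lows, lows above `λ` are uncharged), so `u·ν(lows) ≤ ν(>λ)`;
* `pool_of_flow_top` — (H_j′) in pool form: `u·ν(lows) ≤ ν(>j′) + u·Σ_{lows} Σ_{m ≤ j′} f⁰(l,m)`;
* **`pool_budget`** — `u·Σ_{lows} dlRest l ≤ (1−g)·ν(>j′) + g·ν(>λ)`: the pool-bound mass of the routing fits into the slice's giant pool.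

[this work]; nothing here is cited as a published result.  The gluing rows served [cite: KozmaNitzan2024, Conjecture 3 (p. 15)]; product
measure [cite: Grimmett1999, §1.3 p. 10].
-/

noncomputable section

namespace Summit.CriticalPhenomena.PercolationContinuityZ3.Theorems

namespace Quant

open Finset

namespace LawDec

section Pool

variable (x T g : ℝ) (j' M a : ℕ) (ν : ℕ → ℝ) (f0 : ℕ → ℕ → ℝ)

/-! ### The giant pool: `g·(H_λ) + (1−g)·(H_j′)` -/

/-- **(H_λ) in pool form.**  Under the support hypotheses a deep low is compatible at layer `λ` only with the atoms `> λ` (all giants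
there: band-like atoms `≤ λ` are incompatible), so `u·ν(lows) ≤ ν(>λ)`. [this work] -/
theorem pool_of_flow_lam (fl : ℕ → ℕ → ℝ) (lam : ℕ) (hx0 : 0 < x) (hx1 : x < 1) (hg0 : 0 ≤ g) (hg1 : g ≤ 1)
    (hfl : IsFlowAtT x T lam M ν fl) (hlamj : lam ≤ j')
    (hdeep : ∀ k, k ≤ j' → 2 * (k : ℝ) < T → ν k ≠ 0 → 2 * ((k : ℝ) + a) < T + (a : ℝ) * g ∧ k + a ≤ j')
    (hbelow : ∀ k, k ≤ lam → T ≤ 2 * (k : ℝ) → ν k ≠ 0 → 2 * (k : ℝ) ≤ T + (a : ℝ) * g)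
    (habove : ∀ k, lam < k → k ≤ j' → ν k ≠ 0 → T + (a : ℝ) * g < 2 * (k : ℝ)) :
    x / (1 - x) * ∑ l ∈ Finset.range (j' + 1), (if 2 * (l : ℝ) < T then ν l else 0)
      ≤ ∑ h ∈ Finset.Ico (lam + 1) (M + 1), ν h := by
  have hag : 0 ≤ (a : ℝ) * g := mul_nonneg (Nat.cast_nonneg a) hg0
  -- charged flow of `f^λ` goes into the atoms `> λ` only
  have hgiant : ∀ l h, 0 < fl l h → lam + 1 ≤ h := by
    intro l h hlh
    obtain ⟨hl, hlow, hhM, hc⟩ := hfl.2.1 l h hlh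
    rcases hc with hc | hc
    · exact hc
    by_contra hle
    have hle' : h ≤ lam := by omega
    have hνl : 0 < ν l := by
      rw [← hfl.2.2.1 l hl hlow]
      exact lt_of_lt_of_le hlh (Finset.single_le_sum (fun h _ => hfl.1 l h) (Finset.mem_range.2 (by omega)))
    have hd := (hdeep l (hl.trans hlamj) hlow hνl.ne').1
    have h2 : T ≤ 2 * (h : ℝ) := by linarith
    have hlh' : l < h := by
      have : (l : ℝ) < h := by linarith
      exact_mod_cast this
    have hupos := usage_pos_of_compat x T lam l h hx0 hx1 hlow hlh' (Or.inr hc)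
    have hcap := hfl.2.2.2 h hhM (Or.inr h2)
    have hterm : usage x T lam l h * fl l h ≤ ∑ l' ∈ Finset.range (lam + 1), usage x T lam l' h * fl l' h := by
      refine Finset.single_le_sum (f := fun l' => usage x T lam l' h * fl l' h) (fun l' _ => ?_)
        (Finset.mem_range.2 (by omega))
      show 0 ≤ usage x T lam l' h * fl l' h
      rcases (hfl.1 l' h).eq_or_lt with hz | hp
      · rw [← hz, mul_zero]
      · obtain ⟨-, hlow', -, hc'⟩ := hfl.2.1 l' h hp
        have hl'h : l' < h := by
          rcases hc' with hc' | hc'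
          · omega
          · have : (l' : ℝ) < h := by linarith
            exact_mod_cast this
        exact (mul_pos (usage_pos_of_compat x T lam l' h hx0 hx1 hlow' hl'h hc') hp).le
    have hνh : 0 < ν h := lt_of_lt_of_le (lt_of_lt_of_le (mul_pos hupos hlh) hterm) hcap
    have hb := hbelow h hle' h2 hνh.ne'
    have ha0 : (0 : ℝ) ≤ a := Nat.cast_nonneg a
    nlinarith
  -- lows above λ carry no mass
  have hzero : ∀ l, l ≤ j' → 2 * (l : ℝ) < T → lam < l → ν l = 0 := by
    intro l hl hlow hlt
    by_contra hne
    have := habove l hlt hl hne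
    linarith
  have e1 : ∑ l ∈ Finset.range (j' + 1), (if 2 * (l : ℝ) < T then ν l else 0)
      = ∑ l ∈ Finset.range (lam + 1), (if 2 * (l : ℝ) < T then ν l else 0) := by
    symm
    refine Finset.sum_subset (Finset.range_mono (by omega)) fun l hl hnl => ?_
    rw [Finset.mem_range] at hl hnl
    split_ifs with hlow
    · exact hzero l (by omega) hlow (by omega)
    · rfl
  rw [e1, Finset.mul_sum]
  -- per low: u·ν_l = Σ_h u·f^λ(l,h)
  have e2 : ∀ l ∈ Finset.range (lam + 1), x / (1 - x) * (if 2 * (l : ℝ) < T then ν l else 0)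
      = ∑ h ∈ Finset.range (M + 1), (if 2 * (l : ℝ) < T then x / (1 - x) * fl l h else 0) := by
    intro l hl
    have hl' : l ≤ lam := Nat.lt_succ_iff.1 (Finset.mem_range.1 hl)
    split_ifs with hlow
    · rw [← hfl.2.2.1 l hl' hlow, Finset.mul_sum]
    · rw [mul_zero, Finset.sum_const_zero]
  rw [Finset.sum_congr rfl e2, Finset.sum_comm, ← sum_range_ite_gt_eq_Ico lam M ν]
  refine Finset.sum_le_sum fun h hh => ?_
  have hhM : h ≤ M := Nat.lt_succ_iff.1 (Finset.mem_range.1 hh)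
  by_cases hgi : lam + 1 ≤ h
  · rw [if_pos hgi]
    refine le_trans (Finset.sum_le_sum fun l _ => ?_) (hfl.2.2.2 h hhM (Or.inl hgi))
    split_ifs with hlow
    · rw [usage_giant_eq x T lam l h hgi]
    · rcases (hfl.1 l h).eq_or_lt with hz | hp
      · rw [← hz, mul_zero]
      · exact absurd (hfl.2.1 l h hp).2.1 hlow
  · rw [if_neg hgi]
    refine (Finset.sum_eq_zero fun l _ => ?_).le
    split_ifs with hlow
    · rcases (hfl.1 l h).eq_or_lt with hz | hp
      · rw [← hz, mul_zero]
      · exact absurd (hgiant l h hp) hgi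
    · rfl

/-- **(H_j′) in pool form**: `u·ν(lows) ≤ ν(>j′) + u·Σ_{lows} Σ_{m ≤ j′} f⁰(l,m)`. [this work] -/
theorem pool_of_flow_top (hx0 : 0 < x) (hx1 : x < 1) (hf0 : IsFlowAtT x T j' M ν f0) :
    x / (1 - x) * ∑ l ∈ Finset.range (j' + 1), (if 2 * (l : ℝ) < T then ν l else 0)
      ≤ ∑ h ∈ Finset.Ico (j' + 1) (M + 1), ν h
        + x / (1 - x) * ∑ l ∈ Finset.range (j' + 1), (if 2 * (l : ℝ) < T then ∑ m ∈ Finset.range (j' + 1), f0 l m else 0) := by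
  have hu : 0 ≤ x / (1 - x) := div_nonneg hx0.le (by linarith)
  -- per low: ν_l = (mass shipped to the giants) + (mass shipped to `≤ j′`)
  have hsplit : ∀ l ∈ Finset.range (j' + 1), (if 2 * (l : ℝ) < T then ν l else 0)
      = (∑ h ∈ Finset.range (M + 1), (if 2 * (l : ℝ) < T ∧ j' + 1 ≤ h then f0 l h else 0))
        + (∑ h ∈ Finset.range (M + 1), (if 2 * (l : ℝ) < T ∧ h ≤ j' then f0 l h else 0)) := by
    intro l hl
    have hl' : l ≤ j' := Nat.lt_succ_iff.1 (Finset.mem_range.1 hl)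
    by_cases hlow : 2 * (l : ℝ) < T
    · rw [if_pos hlow, ← hf0.2.2.1 l hl' hlow, ← Finset.sum_add_distrib]
      refine Finset.sum_congr rfl fun h _ => ?_
      by_cases hgi : j' + 1 ≤ h
      · rw [if_pos ⟨hlow, hgi⟩, if_neg (fun hc => by omega), add_zero]
      · rw [if_neg (fun hc => hgi hc.2), if_pos ⟨hlow, by omega⟩, zero_add]
    · rw [if_neg hlow]
      have hz1 : ∑ h ∈ Finset.range (M + 1), (if 2 * (l : ℝ) < T ∧ j' + 1 ≤ h then f0 l h else 0) = 0 :=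
        Finset.sum_eq_zero fun h _ => by rw [if_neg (fun hc => hlow hc.1)]
      have hz2 : ∑ h ∈ Finset.range (M + 1), (if 2 * (l : ℝ) < T ∧ h ≤ j' then f0 l h else 0) = 0 :=
        Finset.sum_eq_zero fun h _ => by rw [if_neg (fun hc => hlow hc.1)]
      rw [hz1, hz2, add_zero]
  -- the giant part is bounded by the capacity rows of `f⁰`
  have hgiants : x / (1 - x) * ∑ l ∈ Finset.range (j' + 1), ∑ h ∈ Finset.range (M + 1),
      (if 2 * (l : ℝ) < T ∧ j' + 1 ≤ h then f0 l h else 0) ≤ ∑ h ∈ Finset.Ico (j' + 1) (M + 1), ν h := by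
    rw [Finset.sum_comm, ← sum_range_ite_gt_eq_Ico j' M ν, Finset.mul_sum]
    refine Finset.sum_le_sum fun h hh => ?_
    have hhM : h ≤ M := Nat.lt_succ_iff.1 (Finset.mem_range.1 hh)
    by_cases hgi : j' + 1 ≤ h
    · rw [if_pos hgi, Finset.mul_sum]
      refine le_trans (Finset.sum_le_sum fun l _ => ?_) (hf0.2.2.2 h hhM (Or.inl hgi))
      by_cases hlow : 2 * (l : ℝ) < T
      · rw [if_pos ⟨hlow, hgi⟩, usage_giant_eq x T j' l h hgi]
      · rw [if_neg (fun hc => hlow hc.1), mul_zero]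
        rcases (hf0.1 l h).eq_or_lt with hz | hp
        · rw [← hz, mul_zero]
        · exact absurd (hf0.2.1 l h hp).2.1 hlow
    · rw [if_neg hgi]
      have hz : ∑ l ∈ Finset.range (j' + 1), (if 2 * (l : ℝ) < T ∧ j' + 1 ≤ h then f0 l h else 0) = 0 :=
        Finset.sum_eq_zero fun l _ => by rw [if_neg (fun hc => hgi hc.2)]
      rw [hz, mul_zero]
  -- the part shipped to `≤ j′` is at most `Σ_{m ≤ j′} f⁰(l,m)`
  have htop : ∑ l ∈ Finset.range (j' + 1), ∑ h ∈ Finset.range (M + 1), (if 2 * (l : ℝ) < T ∧ h ≤ j' then f0 l h else 0)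
      ≤ ∑ l ∈ Finset.range (j' + 1), (if 2 * (l : ℝ) < T then ∑ m ∈ Finset.range (j' + 1), f0 l m else 0) := by
    refine Finset.sum_le_sum fun l _ => ?_
    by_cases hlow : 2 * (l : ℝ) < T
    · rw [if_pos hlow]
      have e : ∑ h ∈ Finset.range (M + 1), (if 2 * (l : ℝ) < T ∧ h ≤ j' then f0 l h else 0)
          = ∑ h ∈ (Finset.range (M + 1)).filter (fun h => h ≤ j'), f0 l h := by
        rw [Finset.sum_filter]
        refine Finset.sum_congr rfl fun h _ => ?_
        by_cases hhj : h ≤ j'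
        · rw [if_pos ⟨hlow, hhj⟩, if_pos hhj]
        · rw [if_neg (fun hc => hhj hc.2), if_neg hhj]
      rw [e]
      refine Finset.sum_le_sum_of_subset_of_nonneg ?_ (fun m _ _ => hf0.1 l m)
      intro m hm
      rw [Finset.mem_filter, Finset.mem_range] at hm
      exact Finset.mem_range.2 (by omega)
    · rw [if_neg hlow]
      exact (Finset.sum_eq_zero fun h _ => by rw [if_neg (fun hc => hlow hc.1)]).le
  rw [Finset.sum_congr rfl hsplit, Finset.sum_add_distrib, mul_add]
  exact add_le_add hgiants (mul_le_mul_of_nonneg_left htop hu)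

/-- **THE POOL INEQUALITY**: `u·Σ_{lows} dlRest l ≤ (1−g)·ν(>j′) + g·ν(>λ)`. [this work] -/
theorem pool_budget (fl : ℕ → ℕ → ℝ) (lam : ℕ) (hx0 : 0 < x) (hx1 : x < 1) (hg0 : 0 ≤ g) (hg1 : g ≤ 1) (hg2 : 1 / 2 ≤ g)
    (hν : ∀ k, 0 ≤ ν k) (hf0 : IsFlowAtT x T j' M ν f0) (hfl : IsFlowAtT x T lam M ν fl) (hlamj : lam ≤ j')
    (hdeep : ∀ k, k ≤ j' → 2 * (k : ℝ) < T → ν k ≠ 0 → 2 * ((k : ℝ) + a) < T + (a : ℝ) * g ∧ k + a ≤ j')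
    (hbelow : ∀ k, k ≤ lam → T ≤ 2 * (k : ℝ) → ν k ≠ 0 → 2 * (k : ℝ) ≤ T + (a : ℝ) * g)
    (habove : ∀ k, lam < k → k ≤ j' → ν k ≠ 0 → T + (a : ℝ) * g < 2 * (k : ℝ)) :
    x / (1 - x) * ∑ l ∈ Finset.range (j' + 1), (if 2 * (l : ℝ) < T then dlRest x T g j' a ν f0 l else 0)
      ≤ (1 - g) * ∑ h ∈ Finset.Ico (j' + 1) (M + 1), ν h + g * ∑ h ∈ Finset.Ico (lam + 1) (M + 1), ν h := by
  have hu : 0 < x / (1 - x) := div_pos hx0 (by linarith)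
  have hA := pool_of_flow_lam x T g j' M a ν fl lam hx0 hx1 hg0 hg1 hfl hlamj hdeep hbelow habove
  have hB := pool_of_flow_top x T j' M ν f0 hx0 hx1 hf0
  -- the key step summed over the lows
  have hC : (1 - g) * ∑ l ∈ Finset.range (j' + 1), (if 2 * (l : ℝ) < T then ∑ m ∈ Finset.range (j' + 1), f0 l m else 0)
      ≤ ∑ l ∈ Finset.range (j' + 1), (if 2 * (l : ℝ) < T then ∑ m ∈ Finset.range (j' + 1), dlAd x T g j' a ν f0 l m else 0) := by
    rw [Finset.mul_sum]
    refine Finset.sum_le_sum fun l hl => ?_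
    have hl' : l ≤ j' := Nat.lt_succ_iff.1 (Finset.mem_range.1 hl)
    split_ifs with hlow
    · exact sum_dlAd_ge x T g j' M a ν f0 hx0 hx1 hg1 hg2 hν hf0 hdeep l hl' hlow
    · simp
  -- dlRest = ν − Σ dlAd
  have e : ∑ l ∈ Finset.range (j' + 1), (if 2 * (l : ℝ) < T then dlRest x T g j' a ν f0 l else 0)
      = ∑ l ∈ Finset.range (j' + 1), (if 2 * (l : ℝ) < T then ν l else 0)
        - ∑ l ∈ Finset.range (j' + 1), (if 2 * (l : ℝ) < T then ∑ m ∈ Finset.range (j' + 1), dlAd x T g j' a ν f0 l m else 0) := by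
    rw [← Finset.sum_sub_distrib]
    refine Finset.sum_congr rfl fun l _ => ?_
    unfold dlRest
    split_ifs <;> ring
  rw [e, mul_sub]
  set S := ∑ l ∈ Finset.range (j' + 1), (if 2 * (l : ℝ) < T then ν l else 0) with hS
  set F := ∑ l ∈ Finset.range (j' + 1), (if 2 * (l : ℝ) < T then ∑ m ∈ Finset.range (j' + 1), f0 l m else 0) with hF
  set D := ∑ l ∈ Finset.range (j' + 1), (if 2 * (l : ℝ) < T then ∑ m ∈ Finset.range (j' + 1), dlAd x T g j' a ν f0 l m else 0)
  set Gj := ∑ h ∈ Finset.Ico (j' + 1) (M + 1), ν h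
  set Gl := ∑ h ∈ Finset.Ico (lam + 1) (M + 1), ν h
  -- u·S = g·(u·S) + (1−g)·(u·S) ≤ g·Gl + (1−g)·(Gj + u·F), and u·D ≥ u·(1−g)·F
  have h1 := mul_le_mul_of_nonneg_left hA hg0
  have h2 := mul_le_mul_of_nonneg_left hB (show 0 ≤ 1 - g by linarith)
  have h3 := mul_le_mul_of_nonneg_left hC hu.le
  have hmix : x / (1 - x) * S = g * (x / (1 - x) * S) + (1 - g) * (x / (1 - x) * S) := by ring
  nlinarith

end Pool

end LawDec

end Quant

end Summit.CriticalPhenomena.PercolationContinuityZ3.Theorems
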